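import Summits.NavierStokesRegularity.FunctionalMining.NoGo.TopEigHeatCoerciveOne
import Summits.NavierStokesRegularity.FunctionalMining.NoGo.TopEigLaminateHeatLine
import Summits.NavierStokesRegularity.FunctionalMining.StretchingLaminateWindows
import Summits.NavierStokesRegularity.FunctionalMining.NoGo.TopBotEigHeatWindow
import HarnessLib

/-!
# FunctionalMining — the MOLLIFIED OPTIMAL LAMINATE: heat line of `F′ = S·(S² + ε)^{1/q − 1/2}`
# (`S = sin 2π·`, `ε > 0`) and its drop rate `R_ε(q) = −4π²q·N_ε(q)/D_ε(q)` for every real `q ≥ 1`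

HONEST FRAMING. Search for candidate a priori estimates; no regularity claim. Nothing about
Navier–Stokes is proved or asserted in this file: it evaluates the dictionary's STATIC heat-line functional
(`heatDissipation Φ v = sup_{t>0} (Φ(v) − Φ(v + tΔv))/t`, `TopEigHeatCoercive.lean`; no transport, no pressure)
along the heat line of ONE explicit two-parameter family of smooth divergence-free zero-mean laminates of `T³`
— the input the sequel `TopEigHeatMollifiedCeiling.lean` books against `C_λ(q) = TopEig.topEigHeatRate q`
(`TopEigHeatRate.lean`), `C_λ^−(q)` and K6's `C_λ^sym(q) = topBotEigHeatRate q` (`NoGo/TopBotEigHeatWindow.lean`) and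
passes to the limit `ε ↓ 0`. Cell `pub-nsfunc`, prove seat (gen 31), own lane; sequel of the no-go seat's
K32/K33a/K33b/K34a/K34b (laminate ceilings `36π²q(q−1)/(3q−1)` and `ρ(q,b)`, same line formula and Bernoulli step).

WHY. Among `x₂`-laminates `u_F = (F(x₂), 0, 0)` the heat price of `Φ_q = ∫(λ₁⁺)^q` is (pen)
`q(q−1)∫|F′|^{q−2}F″² / ∫|F′|^q · Φ_q = (4(q−1)/q)·(∫H′²/∫H²)·Φ_q` with `H = |F′|^{q/2} sgn F′`, so the laminate
OPTIMUM is `16π²(q−1)/q` (`H = sin`; the matching FLOOR on the laminate class is the no-go seat's K40b/K40d with the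
lit seat's half-shift Wirtinger inequality). The optimal profile `F′ = |S|^{2/q} sgn S` is NOT smooth at the zeros
of `S` unless `2/q` is an odd integer, so no single smooth laminate attains it; this file runs the smooth
MOLLIFICATION `F′_ε = S·(S² + ε)^{α}`, `α = 1/q − 1/2`, for which every `rpow` factor is a power of the POSITIVE
smooth function `W = S² + ε`, and for which (the point of the construction) the Bernoulli numerator is a BOUNDED
function uniformly in `ε` — every term of the second-derivative bracket carries a factor `W` — so that the sequel
`TopEigHeatMollifiedCeiling.lean` can pass to the limit `ε ↓ 0` by dominated convergence with a constant dominator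
and obtain `C_λ(q) ≤ 16π²(q−1)/q` for every real `q > 1`.

CONTENT (`q > 0`, `ε > 0`, `α = 1/q − 1/2`; `S = sin 2πs`, `C = cos 2πs`, `W = S² + ε`).
* §1 the family: `mollBase ε s = W > 0`, `mollG q ε = S·W^α` (a `ShearProfile`), `G(s + ½) = −G(s)`, `∫₀¹ G = 0`,
  the zero-mean periodic primitive `mollF` (`LaminateWindow.primitive`/`subConst`), `F′ = G`, `F‴ = G″`, and the
  zero-mean laminate `lamU mollF`;
* §2 derivatives: `G′ = 2πC·W^{α−1}(W + 2αS²)` and **`G″ = 4π²·S·W^{α−2}·B`** with the bracket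
  `B = mollB α (S²) W := −W(W + 2αS²) + 2(α−1)(1−S²)(W + 2αS²) + 2(1+2α)(1−S²)W` (`mollG_DD`), hence the
  FACTORISED HEAT LINE **`G + tG″ = S·W^{α−2}·(W² + t·4π²B)`** (`mollG_line`);
* §3 with K33a's tangent-form Bernoulli at `a = W²` (`tangent_le_abs_rpow`) the `rpow` factors combine
  (`(α−2)q + 2q = 1 − q/2`, `(α−2)q + 2q − 2 = −1 − q/2`): POINTWISE for every real `t` and `q ≥ 1`
  **`|S|^q W^{1−q/2} + t·q·4π²·|S|^q W^{−1−q/2}·B ≤ |F′ + tF‴|^q`** (`mollLine_rpow_ge`), `|F′|^q = |S|^q W^{1−q/2}`;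
* §4 integrating over `[0,1]` (both integrands are continuous): with `D_ε(q) := ∫₀¹|S|^qW^{1−q/2} > 0` (`mollDen`)
  and `N_ε(q) := ∫₀¹|S|^qW^{−1−q/2}B` (`mollNum`) the HEAT-LINE DROP of the witness laminate obeys
  **`∫|F′|^q − ∫|F′ + tF‴|^q ≤ t·R_ε(q)·∫|F′|^q`** for every real `t`, `R_ε(q) := −4π²q·N_ε(q)/D_ε(q)` (`mollRate`,
  `integral_mollLine_drop_le`). The bookings `C_λ(q) ≤ R_ε(q)` (K33b's pattern), the uniform bounds `|n_ε| ≤ 14`,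
  `0 ≤ d_ε ≤ 2` on the two integrands for `0 < ε ≤ 1`, and the limit `R_ε(q) → 16π²(q−1)/q` are the sequel's.

SCOPE, EXACTLY: identities and inequalities of one-variable calculus for an explicit family; no functional of the
dictionary is booked here (the sequel does that) and the value of `lim_{ε↓0} R_ε(q)` is not computed here. Lemma
L-λ(q) (`C_λ(q) > 0`, `@[conjecture] TopEig.TopEigHeatCoercivePos q`) stays OPEN in the kernel for every real `q > 1`;
the laminates are NOT kills (their heat price is positive); no node of the cell is decided; nothing about `q < 1`.
[ours] = the family and §§ 1–4 as stated; [tree] = everything imported; folklore = Bernoulli, calculus.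
FILING (prove seat g31, SLOT OWN-M1, LEAD (ρρρρρρρρ) INBOX l.5608): = staged `pub-nsfunc-prove/staged/g31-own/TopEigHeatMollifiedLine.lean` de8dd52633dee6ee; this line is the only addition.
-/

noncomputable section

open MeasureTheory Set intervalIntegral Real
open scoped ContDiff Topology

namespace Summit.NavierStokesRegularity.FunctionalMining

open Literature.Analysis Literature.Analysis.FunctionSpaces Literature.Analysis.FunctionSpaces.Torus
open TopEig PlanarTopEig StrainL4 LaminateDirection LaminateWindow

namespace TopEigLaminate

/-! ## 1. The mollified family `G_{q,ε} = S·(S² + ε)^{1/q − 1/2}` and its zero-mean primitive -/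

/-- The positive base `W_ε(s) = sin²(2πs) + ε`. [ours, bookkeeping] -/
def mollBase (ε s : ℝ) : ℝ := sin (2 * π * s) ^ 2 + ε

/-- `W_ε > 0` for `ε > 0`. [ours, bookkeeping] -/
theorem mollBase_pos {ε : ℝ} (hε : 0 < ε) (s : ℝ) : 0 < mollBase ε s := by
  unfold mollBase; positivity

/-- `S² ≤ W_ε` for `ε ≥ 0`. [ours, bookkeeping] -/
theorem sin_sq_le_mollBase {ε : ℝ} (hε : 0 ≤ ε) (s : ℝ) : sin (2 * π * s) ^ 2 ≤ mollBase ε s := by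
  unfold mollBase; linarith

/-- `W_ε ≤ 1 + ε`. [ours, bookkeeping] -/
theorem mollBase_le (ε s : ℝ) : mollBase ε s ≤ 1 + ε := by
  unfold mollBase; linarith [sin_sq_le_one (2 * π * s)]

/-- `W_ε(s + 1) = W_ε(s)`. [ours, bookkeeping] -/
theorem mollBase_add_one (ε s : ℝ) : mollBase ε (s + 1) = mollBase ε s := by
  unfold mollBase; rw [mul_add, mul_one, sin_add_two_pi]

/-- `W_ε(s + ½) = W_ε(s)`. [ours, bookkeeping] -/
theorem mollBase_add_half (ε s : ℝ) : mollBase ε (s + 1 / 2) = mollBase ε s := by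
  unfold mollBase; rw [show 2 * π * (s + 1 / 2) = 2 * π * s + π by ring, sin_add_pi, neg_sq]

/-- `s ↦ W_ε(s)` is smooth. [folklore] -/
theorem contDiff_mollBase (ε : ℝ) : ContDiff ℝ ∞ (mollBase ε) :=
  ((contDiff_sin.comp (contDiff_const.mul contDiff_id)).pow 2).add contDiff_const

/-- `s ↦ W_ε(s)` is continuous. [folklore] -/
theorem continuous_mollBase (ε : ℝ) : Continuous (mollBase ε) := (contDiff_mollBase ε).continuous

/-- `W_ε′(s) = 4π sin(2πs) cos(2πs)`. [ours, bookkeeping] -/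
theorem hasDerivAt_mollBase (ε s : ℝ) :
    HasDerivAt (mollBase ε) (4 * π * sin (2 * π * s) * cos (2 * π * s)) s := by
  have h := ((hasDerivAt_sin_two_pi_mul s).fun_pow 2).add_const ε
  refine h.congr_deriv ?_
  simp only [Nat.cast_ofNat, Nat.add_one_sub_one, pow_one]
  ring

/-- The mollification exponent `α = 1/q − 1/2`. [ours, bookkeeping] -/
def mollExp (q : ℝ) : ℝ := 1 / q - 1 / 2

/-- `α·q = 1 − q/2` (`q ≠ 0`). [ours, bookkeeping] -/
theorem mollExp_mul {q : ℝ} (hq : q ≠ 0) : mollExp q * q = 1 - q / 2 := by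
  unfold mollExp; rw [sub_mul, one_div_mul_cancel hq]; ring

/-- **The derivative profile of the family, `G_{q,ε}(s) = sin(2πs)·(sin²(2πs) + ε)^{1/q−1/2}`** (`ε > 0`):
smooth and `1`-periodic. [ours] -/
def mollG (q ε : ℝ) (hε : 0 < ε) : ShearProfile where
  toFun := fun s => sin (2 * π * s) * mollBase ε s ^ mollExp q
  periodic' := fun s => by
    show sin (2 * π * (s + 1)) * mollBase ε (s + 1) ^ mollExp q = sin (2 * π * s) * mollBase ε s ^ mollExp q
    rw [mollBase_add_one, mul_add, mul_one, sin_add_two_pi]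
  contDiff' := (contDiff_sin.comp (contDiff_const.mul contDiff_id)).mul
    ((contDiff_mollBase ε).rpow_const_of_ne fun s => (mollBase_pos hε s).ne')

variable {q ε : ℝ} (hε : 0 < ε)

/-- Values of `G_{q,ε}`. [ours, bookkeeping] -/
theorem mollG_apply (s : ℝ) : mollG q ε hε s = sin (2 * π * s) * mollBase ε s ^ mollExp q := rfl

/-- **`G(s + ½) = −G(s)`.** [ours, bookkeeping] -/
theorem mollG_add_half (s : ℝ) : mollG q ε hε (s + 1 / 2) = -mollG q ε hε s := by
  rw [mollG_apply, mollG_apply, mollBase_add_half, show 2 * π * (s + 1 / 2) = 2 * π * s + π by ring, sin_add_pi]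
  ring

/-- **`∫₀¹ G_{q,ε} = 0`** (the two half-periods cancel). [ours] -/
theorem integral_mollG : ∫ s in (0 : ℝ)..1, mollG q ε hε s = 0 := by
  have hi : ∀ u v : ℝ, IntervalIntegrable (mollG q ε hε) volume u v := fun u v =>
    (mollG q ε hε).continuous.intervalIntegrable u v
  rw [← integral_add_adjacent_intervals (hi 0 (1 / 2)) (hi (1 / 2) 1)]
  have h2 : ∫ s in (1 / 2 : ℝ)..1, mollG q ε hε s = ∫ s in (0 : ℝ)..(1 / 2), mollG q ε hε (s + 1 / 2) := by
    rw [intervalIntegral.integral_comp_add_right (fun s => mollG q ε hε s)]; norm_num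
  rw [h2]
  simp only [mollG_add_half, intervalIntegral.integral_neg, add_neg_cancel]

/-- The periodic primitive `∫₀ᵗ G_{q,ε}`. [ours, bookkeeping] -/
def mollPrim (q ε : ℝ) (hε : 0 < ε) : ShearProfile := primitive (mollG q ε hε) (integral_mollG hε)

/-- **THE WITNESS PROFILE `F_{q,ε}`**: the zero-mean `1`-periodic primitive of `G_{q,ε}`. [ours] -/
def mollF (q ε : ℝ) (hε : 0 < ε) : ShearProfile :=
  subConst (mollPrim q ε hε) (∫ s in (0 : ℝ)..1, mollPrim q ε hε s)

/-- **`F′ = G`** (pointwise). [ours] -/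
theorem mollF_D_apply (s : ℝ) : (mollF q ε hε).D s = mollG q ε hε s := by
  rw [ShearProfile.D_apply, show ((mollF q ε hε : ShearProfile) : ℝ → ℝ) =
    fun t => mollPrim q ε hε t - ∫ s in (0 : ℝ)..1, mollPrim q ε hε s from rfl, deriv_sub_const]
  exact deriv_primitive _ _ s

/-- `deriv F = G` (as functions). [ours, bookkeeping] -/
theorem deriv_mollF : deriv (mollF q ε hε : ℝ → ℝ) = mollG q ε hε := by
  funext s; have h := mollF_D_apply (q := q) hε s; rwa [ShearProfile.D_apply] at h

/-- **`F‴ = G″`** (pointwise). [ours, bookkeeping] -/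
theorem mollF_DDD_apply (s : ℝ) : (mollF q ε hε).D.D.D s = (mollG q ε hε).D.D s := by
  simp only [ShearProfile.coe_D, deriv_mollF]

/-- **`∫₀¹ F_{q,ε} = 0`.** [ours] -/
theorem integral_mollF : ∫ s in (0 : ℝ)..1, mollF q ε hε s = 0 := by
  show ∫ s in (0 : ℝ)..1, (mollPrim q ε hε s - ∫ s in (0 : ℝ)..1, mollPrim q ε hε s) = 0
  rw [intervalIntegral.integral_sub ((mollPrim q ε hε).continuous.intervalIntegrable 0 1)
    intervalIntegrable_const, intervalIntegral.integral_const]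
  simp

/-- **The laminate `u_F = (F_{q,ε}(x₂), 0, 0)` has zero mean** (smooth and divergence free by `isSmooth_lamU`,
`isDivFree_lamU`). [ours] -/
theorem hasZeroMean_lamU_mollF : Torus.HasZeroMean (lamU (mollF q ε hε)) :=
  hasZeroMean_lamU _ (integral_mollF hε)

/-! ## 2. Derivatives of `G_{q,ε}` and the factorised heat line -/

/-- **`G′(s) = 2π cos(2πs)·W^{α−1}·(W + 2α sin²(2πs))`** as a derivative. [ours] -/
theorem hasDerivAt_mollG (s : ℝ) : HasDerivAt (mollG q ε hε : ℝ → ℝ)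
    (2 * π * cos (2 * π * s) * mollBase ε s ^ (mollExp q - 1) *
      (mollBase ε s + 2 * mollExp q * sin (2 * π * s) ^ 2)) s := by
  have hW := mollBase_pos hε s
  have h := (hasDerivAt_sin_two_pi_mul s).fun_mul
    ((hasDerivAt_mollBase ε s).rpow_const (p := mollExp q) (Or.inl hW.ne'))
  refine h.congr_deriv ?_
  have e : mollBase ε s ^ mollExp q = mollBase ε s ^ (mollExp q - 1) * mollBase ε s := by
    conv_lhs => rw [show mollExp q = (mollExp q - 1) + 1 by ring, rpow_add hW, rpow_one]
  rw [e]; ring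

/-- **`G′`** (pointwise). [ours] -/
theorem mollG_D (s : ℝ) : (mollG q ε hε).D s = 2 * π * cos (2 * π * s) * mollBase ε s ^ (mollExp q - 1) *
    (mollBase ε s + 2 * mollExp q * sin (2 * π * s) ^ 2) := by
  rw [ShearProfile.D_apply]; exact (hasDerivAt_mollG hε s).deriv

/-- **The second-derivative bracket** `B(α; x, W) = −W(W + 2αx) + 2(α−1)(1−x)(W + 2αx) + 2(1+2α)(1−x)W`
(used at `x = sin²(2πs)`, `W = W_ε(s)`; every term carries a factor `W` or `x ≤ W`). [ours, bookkeeping] -/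
def mollB (α x W : ℝ) : ℝ :=
  -(W * (W + 2 * α * x)) + 2 * (α - 1) * (1 - x) * (W + 2 * α * x) + 2 * (1 + 2 * α) * (1 - x) * W

/-- **`G″(s) = 4π²·sin(2πs)·W^{α−2}·B(α; sin²(2πs), W)`.** [ours] -/
theorem mollG_DD (s : ℝ) : (mollG q ε hε).D.D s =
    4 * π ^ 2 * sin (2 * π * s) * mollBase ε s ^ (mollExp q - 2) *
      mollB (mollExp q) (sin (2 * π * s) ^ 2) (mollBase ε s) := by
  have hW := mollBase_pos hε s
  have hS := hasDerivAt_sin_two_pi_mul s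
  have hC := hasDerivAt_cos_two_pi_mul s
  have hY := hasDerivAt_mollBase ε s
  have h := ((hC.const_mul (2 * π)).fun_mul (hY.rpow_const (p := mollExp q - 1) (Or.inl hW.ne'))).fun_mul
    (hY.fun_add ((hS.fun_pow 2).const_mul (2 * mollExp q)))
  rw [ShearProfile.D_apply, show ((mollG q ε hε).D : ℝ → ℝ) = fun s => 2 * π * cos (2 * π * s) *
      mollBase ε s ^ (mollExp q - 1) * (mollBase ε s + 2 * mollExp q * sin (2 * π * s) ^ 2) from
      funext (mollG_D hε), h.deriv]
  simp only [Nat.cast_ofNat, Nat.add_one_sub_one, pow_one]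
  have e1 : mollBase ε s ^ (mollExp q - 1 - 1) = mollBase ε s ^ (mollExp q - 2) := by
    rw [show (mollExp q - 1 - 1 : ℝ) = mollExp q - 2 by ring]
  have e2 : mollBase ε s ^ (mollExp q - 1) = mollBase ε s ^ (mollExp q - 2) * mollBase ε s := by
    conv_lhs => rw [show (mollExp q - 1 : ℝ) = (mollExp q - 2) + 1 by ring, rpow_add hW, rpow_one]
  rw [e1, e2]
  unfold mollB mollBase
  have hsc := sin_sq_add_cos_sq (2 * π * s)
  set S := sin (2 * π * s)
  set C := cos (2 * π * s)
  set a := mollExp q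
  set Y := (S ^ 2 + ε) ^ (a - 2)
  linear_combination (4 * π ^ 2 * S * Y * (2 * (a - 1) * (S ^ 2 + ε + 2 * a * S ^ 2) +
    2 * (1 + 2 * a) * (S ^ 2 + ε))) * hsc

/-- **THE FACTORISED HEAT LINE: `G + tG″ = S·W^{α−2}·(W² + t·4π²B)`.** [ours] -/
theorem mollG_line (t s : ℝ) : mollG q ε hε s + t * (mollG q ε hε).D.D s =
    sin (2 * π * s) * mollBase ε s ^ (mollExp q - 2) *
      (mollBase ε s ^ 2 + t * (4 * π ^ 2 * mollB (mollExp q) (sin (2 * π * s) ^ 2) (mollBase ε s))) := by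
  have e : mollBase ε s ^ mollExp q = mollBase ε s ^ (mollExp q - 2) * mollBase ε s ^ 2 := by
    rw [← rpow_two, ← rpow_add (mollBase_pos hε s), show (mollExp q - 2 + 2 : ℝ) = mollExp q by ring]
  rw [mollG_DD hε, mollG_apply, e]; ring

/-! ## 3. The pointwise bound along the heat line (the `rpow` factors combine) -/

/-- **`|G|^q = |S|^q·W^{1−q/2}`** (`q > 0`). [ours] -/
theorem mollG_abs_rpow (hq : 0 < q) (s : ℝ) :
    |mollG q ε hε s| ^ q = |sin (2 * π * s)| ^ q * mollBase ε s ^ (1 - q / 2) := by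
  have hW := mollBase_pos hε s
  rw [mollG_apply, abs_mul, abs_of_pos (rpow_pos_of_pos hW _), mul_rpow (abs_nonneg _) (rpow_nonneg hW.le _),
    ← rpow_mul hW.le, mollExp_mul hq.ne']

/-- **POINTWISE BOUND along the heat line of the family** (`q ≥ 1`, every real `t`; `S = sin 2πs`, `W = W_ε(s)`,
`B = B(α; S², W)`): `|S|^q·W^{1−q/2} + t·q·4π²·|S|^q·W^{−1−q/2}·B ≤ |G(s) + tG″(s)|^q`. [ours] -/
theorem mollLine_rpow_ge (hq : 1 ≤ q) (t s : ℝ) :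
    |sin (2 * π * s)| ^ q * mollBase ε s ^ (1 - q / 2) +
        t * (q * (4 * π ^ 2 * (|sin (2 * π * s)| ^ q * mollBase ε s ^ (-1 - q / 2) *
          mollB (mollExp q) (sin (2 * π * s) ^ 2) (mollBase ε s)))) ≤
      |mollG q ε hε s + t * (mollG q ε hε).D.D s| ^ q := by
  have hq0 : q ≠ 0 := ne_of_gt (by linarith)
  have hW := mollBase_pos hε s
  set S := sin (2 * π * s) with hSdef
  set W := mollBase ε s with hWdef
  set a := mollExp q with hadef
  set B := mollB a (S ^ 2) W with hBdef
  have hY : 0 < W ^ (a - 2) := rpow_pos_of_pos hW _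
  have hb' := tangent_le_abs_rpow (P := W ^ 2 + t * (4 * π ^ 2 * B)) (sq_nonneg W) hq
  have hm := mul_le_mul_of_nonneg_left hb' (rpow_nonneg (abs_nonneg (S * W ^ (a - 2))) q)
  rw [← mul_rpow (abs_nonneg _) (abs_nonneg _), ← abs_mul, hBdef, hadef, hWdef, hSdef, ← mollG_line hε t s] at hm
  refine le_trans (le_of_eq ?_) hm
  have haq : a * q = 1 - q / 2 := by rw [hadef]; exact mollExp_mul hq0
  have eabs : |S * W ^ (a - 2)| ^ q = |S| ^ q * W ^ (1 - q / 2 - 2 * q) := by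
    rw [abs_mul, abs_of_pos hY, mul_rpow (abs_nonneg S) hY.le, ← rpow_mul hW.le]
    rw [show (a - 2) * q = 1 - q / 2 - 2 * q by rw [sub_mul, haq]]
  have e1 : (W ^ 2) ^ q = W ^ (2 * q) := by rw [← rpow_two, ← rpow_mul hW.le]
  have e2 : (W ^ 2) ^ (q - 1) = W ^ (2 * (q - 1)) := by rw [← rpow_two, ← rpow_mul hW.le]
  have eA : W ^ (1 - q / 2 - 2 * q) * W ^ (2 * q) = W ^ (1 - q / 2) := by
    rw [← rpow_add hW, show (1 - q / 2 - 2 * q + 2 * q : ℝ) = 1 - q / 2 by ring]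
  have eB : W ^ (1 - q / 2 - 2 * q) * W ^ (2 * (q - 1)) = W ^ (-1 - q / 2) := by
    rw [← rpow_add hW, show (1 - q / 2 - 2 * q + 2 * (q - 1) : ℝ) = -1 - q / 2 by ring]
  rw [eabs, e1, e2, show W ^ 2 + t * (4 * π ^ 2 * B) - W ^ 2 = t * (4 * π ^ 2 * B) by ring,
    show |S| ^ q * W ^ (1 - q / 2 - 2 * q) * (W ^ (2 * q) + q * W ^ (2 * (q - 1)) * (t * (4 * π ^ 2 * B))) =
      |S| ^ q * (W ^ (1 - q / 2 - 2 * q) * W ^ (2 * q)) +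
        t * (q * (4 * π ^ 2 * (|S| ^ q * (W ^ (1 - q / 2 - 2 * q) * W ^ (2 * (q - 1))) * B))) by ring,
    eA, eB]

/-- **The same bound for the witness profile: `… ≤ |F′(s) + tF‴(s)|^q`** (`q ≥ 1`). [ours] -/
theorem mollF_line_rpow_ge (hq : 1 ≤ q) (t s : ℝ) :
    |sin (2 * π * s)| ^ q * mollBase ε s ^ (1 - q / 2) +
        t * (q * (4 * π ^ 2 * (|sin (2 * π * s)| ^ q * mollBase ε s ^ (-1 - q / 2) *
          mollB (mollExp q) (sin (2 * π * s) ^ 2) (mollBase ε s)))) ≤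
      |(mollF q ε hε).D s + t * (mollF q ε hε).D.D.D s| ^ q := by
  rw [mollF_D_apply, mollF_DDD_apply]; exact mollLine_rpow_ge hε hq t s

/-- **At `t = 0`: `|F′(s) + 0·F‴(s)|^q = |S|^q·W^{1−q/2}`** (`q > 0`). [ours, bookkeeping] -/
theorem mollF_abs_rpow_zero (hq : 0 < q) (s : ℝ) :
    |(mollF q ε hε).D s + 0 * (mollF q ε hε).D.D.D s| ^ q = |sin (2 * π * s)| ^ q * mollBase ε s ^ (1 - q / 2) := by
  rw [zero_mul, add_zero, mollF_D_apply, mollG_abs_rpow hε hq]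

/-! ## 4. Integration over the period: the numerator `N_ε(q)`, the denominator `D_ε(q) > 0`, the drop -/

/-- The `t = 0` integrand `d_ε(s) = |S|^q W^{1−q/2}` is continuous (`q ≥ 0`). [ours, bookkeeping] -/
theorem continuous_mollDenIntegrand (hε : 0 < ε) (hq : 0 ≤ q) :
    Continuous fun s : ℝ => |sin (2 * π * s)| ^ q * mollBase ε s ^ (1 - q / 2) :=
  (continuous_abs_sin_rpow hq).mul ((continuous_mollBase ε).rpow_const fun s => Or.inl (mollBase_pos hε s).ne')

/-- The Bernoulli numerator integrand `n_ε(s) = |S|^q W^{−1−q/2} B(α; S², W)` is continuous (`q ≥ 0`). [ours, bookkeeping] -/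
theorem continuous_mollNumIntegrand (hε : 0 < ε) (hq : 0 ≤ q) :
    Continuous fun s : ℝ => |sin (2 * π * s)| ^ q * mollBase ε s ^ (-1 - q / 2) *
      mollB (mollExp q) (sin (2 * π * s) ^ 2) (mollBase ε s) := by
  refine ((continuous_abs_sin_rpow hq).mul ((continuous_mollBase ε).rpow_const fun s =>
    Or.inl (mollBase_pos hε s).ne')).mul ?_
  unfold mollB mollBase; fun_prop

/-- **The denominator `D_ε(q) := ∫₀¹ |S|^q W^{1−q/2}`** (`= ∫₀¹|F′|^q`). [ours, bookkeeping] -/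
def mollDen (q ε : ℝ) : ℝ := ∫ s in (0 : ℝ)..1, |sin (2 * π * s)| ^ q * mollBase ε s ^ (1 - q / 2)

/-- **The Bernoulli numerator `N_ε(q) := ∫₀¹ |S|^q W^{−1−q/2} B(α; S², W)`.** [ours, bookkeeping] -/
def mollNum (q ε : ℝ) : ℝ :=
  ∫ s in (0 : ℝ)..1, |sin (2 * π * s)| ^ q * mollBase ε s ^ (-1 - q / 2) *
    mollB (mollExp q) (sin (2 * π * s) ^ 2) (mollBase ε s)

/-- **The per-`ε` rate `R_ε(q) := −4π²q·N_ε(q)/D_ε(q)`.** [ours, bookkeeping] -/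
def mollRate (q ε : ℝ) : ℝ := -(4 * π ^ 2 * q * mollNum q ε) / mollDen q ε

/-- **`∫₀¹ |F′|^q = D_ε(q)`** (`q > 0`). [ours] -/
theorem integral_mollF_rpow_zero (hq : 0 < q) :
    ∫ s in (0 : ℝ)..1, |(mollF q ε hε).D s + 0 * (mollF q ε hε).D.D.D s| ^ q = mollDen q ε := by
  unfold mollDen; simp_rw [mollF_abs_rpow_zero hε hq]

/-- **`D_ε(q) > 0`** (`q ≥ 0`; the integrand is positive on `(0, ½)`). [ours, bookkeeping] -/
theorem mollDen_pos (hε : 0 < ε) (hq : 0 ≤ q) : 0 < mollDen q ε := by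
  have hc := continuous_mollDenIntegrand (q := q) hε hq
  unfold mollDen
  rw [← intervalIntegral.integral_add_adjacent_intervals (hc.intervalIntegrable 0 (1 / 2))
    (hc.intervalIntegrable (1 / 2) 1)]
  have h1 : 0 < ∫ s in (0 : ℝ)..(1 / 2), |sin (2 * π * s)| ^ q * mollBase ε s ^ (1 - q / 2) := by
    refine intervalIntegral.intervalIntegral_pos_of_pos_on (hc.intervalIntegrable _ _) (fun s hs => ?_)
      (by norm_num)
    refine mul_pos (rpow_pos_of_pos (abs_pos.2 (sin_pos_of_pos_of_lt_pi ?_ ?_).ne') _)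
      (rpow_pos_of_pos (mollBase_pos hε s) _)
    · nlinarith [pi_pos, hs.1]
    · nlinarith [pi_pos, hs.2]
  have h2 : 0 ≤ ∫ s in (1 / 2 : ℝ)..1, |sin (2 * π * s)| ^ q * mollBase ε s ^ (1 - q / 2) :=
    intervalIntegral.integral_nonneg (by norm_num) fun s _ =>
      mul_nonneg (rpow_nonneg (abs_nonneg _) _) (rpow_nonneg (mollBase_pos hε s).le _)
  linarith

/-- **Integrated line bound** (`q ≥ 1`, every real `t`): `D_ε(q) + t·q·4π²·N_ε(q) ≤ ∫₀¹ |F′ + tF‴|^q`. [ours] -/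
theorem integral_mollLine_rpow_ge (hq : 1 ≤ q) (t : ℝ) :
    mollDen q ε + t * (q * (4 * π ^ 2 * mollNum q ε)) ≤
      ∫ s in (0 : ℝ)..1, |(mollF q ε hε).D s + t * (mollF q ε hε).D.D.D s| ^ q := by
  have hA : IntervalIntegrable (fun s : ℝ => |sin (2 * π * s)| ^ q * mollBase ε s ^ (1 - q / 2)) volume 0 1 :=
    (continuous_mollDenIntegrand hε (by linarith)).intervalIntegrable 0 1
  have hB : IntervalIntegrable (fun s : ℝ => t * (q * (4 * π ^ 2 * (|sin (2 * π * s)| ^ q *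
      mollBase ε s ^ (-1 - q / 2) * mollB (mollExp q) (sin (2 * π * s) ^ 2) (mollBase ε s))))) volume 0 1 :=
    (((continuous_mollNumIntegrand hε (by linarith)).intervalIntegrable 0 1).const_mul _).const_mul _ |>.const_mul _
  have hR : IntervalIntegrable (fun s : ℝ => |(mollF q ε hε).D s + t * (mollF q ε hε).D.D.D s| ^ q)
      volume 0 1 :=
    (((mollF q ε hε).D.continuous.add (continuous_const.mul (mollF q ε hε).D.D.D.continuous)).abs.rpow_const
      fun _ => Or.inr (by linarith)).intervalIntegrable 0 1
  refine le_trans (le_of_eq ?_) (intervalIntegral.integral_mono_on zero_le_one (hA.add hB) hR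
    fun s _ => mollF_line_rpow_ge hε hq t s)
  unfold mollDen mollNum
  rw [intervalIntegral.integral_add hA hB, intervalIntegral.integral_const_mul, intervalIntegral.integral_const_mul,
    intervalIntegral.integral_const_mul]

/-- **HEAT-LINE DROP of the mollified witness** (`q ≥ 1`, `ε > 0`, every real `t`):
`∫₀¹|F′|^q − ∫₀¹|F′ + tF‴|^q ≤ t·R_ε(q)·∫₀¹|F′|^q`. [ours] -/
theorem integral_mollLine_drop_le (hq : 1 ≤ q) (t : ℝ) :
    (∫ s in (0 : ℝ)..1, |(mollF q ε hε).D s + 0 * (mollF q ε hε).D.D.D s| ^ q) -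
        ∫ s in (0 : ℝ)..1, |(mollF q ε hε).D s + t * (mollF q ε hε).D.D.D s| ^ q ≤
      t * (mollRate q ε * ∫ s in (0 : ℝ)..1, |(mollF q ε hε).D s + 0 * (mollF q ε hε).D.D.D s| ^ q) := by
  have h := integral_mollLine_rpow_ge hε hq t
  have hD := (mollDen_pos (q := q) hε (by linarith)).ne'
  rw [integral_mollF_rpow_zero hε (by linarith)]
  have E : t * (mollRate q ε * mollDen q ε) = -(t * (q * (4 * π ^ 2 * mollNum q ε))) := by
    unfold mollRate; rw [div_mul_cancel₀ _ hD]; ring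
  linarith [h, E]

end TopEigLaminate

end Summit.NavierStokesRegularity.FunctionalMining

end
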